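import Summits.QuantumFields.YangMills.Theorems.FlatTubeReductionRecordReferenceMass
import Summits.QuantumFields.YangMills.Theorems.FlatTubeReductionReferenceMassBounds
import Summits.QuantumFields.YangMills.Theorems.LuscherReductionTwistedTraceScalingBOStiffCurrencyCut
import HarnessLib

/-!
# The reweighted record reference mass is `O(1) × btC·K₁(1,1)` — the fibre side of the `(C2)`-moments route in the currency of record

Support file for the crux `NearFlatRatioLaw` (line `ratepack_v2`, stub `stub_hODpot_A`; successor step (C) of
`Cruxes/NearFlatRatioLaw/Lines/ratepack-v7-moments-g18.md` §14; memo v8 (g19)).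

Every fibre factor of the integrated core `L²` estimate is, by `…RecordFibreFactor.record_fibre_factor_le_reference_mass`, at most
`β^{-(a+k+j)}·Ξ·𝓡'` with the REWEIGHTED reference mass `𝓡' = fpBOKernel β (recordProfile·(1+β‖x‖²)^4) (fpWeight β⁻¹) 1 1`, and
`…RecordReferenceMass.record_reference_mass_le` prices `𝓡' ≤ K₁(1,1)·V(β)·C_A·θ₀(β)²`, `θ₀ = ∫_{coreBox} recordProfile dπ`.  The currency of the
stub is lane A's `Λ = (btC/fpZ/γ)·λ₀` with `btC·K₁(1,1) = fpBOKernel β recordProfile (coreWeight β⁻¹ R₁) 1 1` (the definition of `btC`).  This file closes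
the gap between the two:
* `fpBOKernel_recordProfile_fpWeight_ge_floor` — the FLOOR `K₁(1,1)·e₀·fpZ β⁻¹·(β^{-3/2}/10)^n·θ₀² ≤ fpBOKernel β recordProfile (fpWeight β⁻¹) 1 1` for `β ≥ 900`
  (`…ReferenceMassBounds.reference_mass_ge_floor` on `coreBox` with `ρ = r₀ = t₀ = β^{-1/2}`; the exponent is `≥ −c_L`, `e₀ = e^{−c_L}` β-INDEPENDENT);
* ★★ `record_reweighted_reference_mass_le_btC` — `∃ Cr β₆, ∀ β ≥ β₆: 𝓡' ≤ Cr·(btC L β recordProfile (btEps β) (5β^{-1/2}ℓ²)·K₁(1,1))`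
  (the floor, `fpBOKernel(fpWeight) = btC·K₁ + cut` `…BTCoreWeight.fpBOKernel_fpWeight_split`, and `cut ≤ btC·K₁` eventually `…BOStiffCurrencyCut.eventually_cut_le_mul_btC`;
  every Gaussian volume factor `fpZ·β^{-3n/2}` cancels: `Cr = 2·10^n·5e·4^{3n}(3n)!(π²/12)^n(3L)^{3n}3^{3n}·C_A/e₀`).
So each fibre factor is `β^{-(a+k+j)}·(Ξ·Cr)·btC·K₁(1,1)`: the currency conversion (R5) becomes scalar algebra.
-/

noncomputable section

open MeasureTheory Filter Topology Real Set
open scoped BigOperators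
open Literature.MathematicalPhysics.QuantumFieldTheory
open Literature.MathematicalPhysics.QuantumLattice

namespace Summit.QuantumFields.YangMills.Theorems.FemtoTransferGap.RateTube

open Summit.QuantumFields.YangMills.Theorems.FemtoTransferGap
open Summit.QuantumFields.YangMills.Theorems.FemtoTransferGap.TwoLattice
open Summit.QuantumFields.YangMills.Theorems.FemtoTransferGap.TwoLattice.ConstTube
open Summit.QuantumFields.YangMills.Theorems.FemtoTransferGap.TwoLattice.Avg
open Summit.QuantumFields.YangMills.Theorems.FemtoTransferGap.TwoLattice.Cov
open Summit.QuantumFields.YangMills.Theorems.FemtoTransferGap.TwoLattice.Stiff (LinkSpace)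

variable (L : ℕ) [NeZero L]

/-- The exponent of `reference_mass_ge_floor` at `ρ = r₀ = t₀ = β^{-1/2}` is bounded below by a β-independent constant (`β ≥ 1`). [folklore] -/
theorem floor_exponent_ge {β : ℝ} (hβ : 1 ≤ β) :
    -((Fintype.card (Edge 3 L) : ℝ) * (2 + 2 * Real.sqrt 2) ^ 2 + 100 * (Fintype.card (Plaquette 3 L × Fin 3) : ℝ) +
        (Fintype.card (Plaquette 3 L) : ℝ) * (29376 + 700569)) ≤
      -(β * ((Fintype.card (Edge 3 L) : ℝ) * (2 * (Real.sqrt β)⁻¹ + 2 * Real.sqrt 2 * (Real.sqrt β)⁻¹) ^ 2)) -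
              β / 2 * (((10 * Real.sqrt (Fintype.card (Plaquette 3 L × Fin 3)) * (Real.sqrt β)⁻¹) ^ 2 + stepActionErr (L := L) (Real.sqrt β)⁻¹ 0) +
                ((10 * Real.sqrt (Fintype.card (Plaquette 3 L × Fin 3)) * (Real.sqrt β)⁻¹) ^ 2 + stepActionErr (L := L) (Real.sqrt β)⁻¹ 0)) := by
  have hβ0 : 0 < β := by linarith
  have hs : 0 < Real.sqrt β := Real.sqrt_pos.2 hβ0
  have hs1 : 1 ≤ Real.sqrt β := by rw [← Real.sqrt_one]; exact Real.sqrt_le_sqrt hβ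
  set t : ℝ := (Real.sqrt β)⁻¹ with ht
  have ht0 : 0 < t := inv_pos.2 hs
  have ht1 : t ≤ 1 := inv_le_one_of_one_le₀ hs1
  have hbt : β * t ^ 2 = 1 := by
    rw [ht, inv_pow, Real.sq_sqrt hβ0.le]; field_simp
  have hN3 : (Real.sqrt (Fintype.card (Plaquette 3 L × Fin 3) : ℝ)) ^ 2 = (Fintype.card (Plaquette 3 L × Fin 3) : ℝ) := Real.sq_sqrt (Nat.cast_nonneg _)
  have hE0 : (0 : ℝ) ≤ Fintype.card (Edge 3 L) := Nat.cast_nonneg _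
  have hP0 : (0 : ℝ) ≤ Fintype.card (Plaquette 3 L) := Nat.cast_nonneg _
  -- term 1
  have e1 : β * ((Fintype.card (Edge 3 L) : ℝ) * (2 * t + 2 * Real.sqrt 2 * t) ^ 2) = (Fintype.card (Edge 3 L) : ℝ) * (2 + 2 * Real.sqrt 2) ^ 2 * (β * t ^ 2) := by ring
  rw [hbt, mul_one] at e1
  -- term 2: `β/2·((10√N₃ t)² + stepActionErr t 0) ≤ 50 N₃ + N_P(29376+700569)/2`
  have hSAE : stepActionErr (L := L) t 0 = (Fintype.card (Plaquette 3 L) : ℝ) * (29376 * t ^ 3 + 700569 * t ^ 4) := by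
    unfold stepActionErr; rw [Real.sqrt_zero, mul_zero, zero_add]
  have hSAE0 : 0 ≤ stepActionErr (L := L) t 0 := stepActionErr_nonneg ht0.le
  have ht3 : β * t ^ 3 ≤ 1 := by
    calc β * t ^ 3 = β * t ^ 2 * t := by ring
      _ ≤ 1 := by rw [hbt, one_mul]; exact ht1
  have ht4 : β * t ^ 4 ≤ 1 := by
    calc β * t ^ 4 = β * t ^ 2 * t ^ 2 := by ring
      _ ≤ 1 := by rw [hbt, one_mul]; nlinarith
  have e2 : β / 2 * ((((10 * Real.sqrt (Fintype.card (Plaquette 3 L × Fin 3))) * t) ^ 2 + stepActionErr (L := L) t 0) +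
        (((10 * Real.sqrt (Fintype.card (Plaquette 3 L × Fin 3))) * t) ^ 2 + stepActionErr (L := L) t 0)) =
      100 * (Fintype.card (Plaquette 3 L × Fin 3) : ℝ) * (β * t ^ 2) +
        (Fintype.card (Plaquette 3 L) : ℝ) * (29376 * (β * t ^ 3) + 700569 * (β * t ^ 4)) := by
    rw [hSAE, mul_pow, mul_pow, hN3]; ring
  have h2 : β / 2 * ((((10 * Real.sqrt (Fintype.card (Plaquette 3 L × Fin 3))) * t) ^ 2 + stepActionErr (L := L) t 0) +
        (((10 * Real.sqrt (Fintype.card (Plaquette 3 L × Fin 3))) * t) ^ 2 + stepActionErr (L := L) t 0)) ≤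
      100 * (Fintype.card (Plaquette 3 L × Fin 3) : ℝ) + (Fintype.card (Plaquette 3 L) : ℝ) * (29376 + 700569) := by
    rw [e2, hbt, mul_one]
    have : (Fintype.card (Plaquette 3 L) : ℝ) * (29376 * (β * t ^ 3) + 700569 * (β * t ^ 4)) ≤ (Fintype.card (Plaquette 3 L) : ℝ) * (29376 + 700569) :=
      mul_le_mul_of_nonneg_left (by nlinarith) hP0
    linarith
  linarith

/-- ★ **The FLOOR of the record reference mass**: for `β ≥ 900`,
`K₁(1,1)·e^{−c_L}·(fpZ β⁻¹·((β^{-1/2})³/10)^n·θ₀(β)²) ≤ fpBOKernel β recordProfile (fpWeight β⁻¹) 1 1`, `θ₀ = ∫_{coreBox} recordProfile dπ`,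
`c_L = |E|(2+2√2)² + 100N₃ + N_P(29376+700569)` (`…ReferenceMassBounds.reference_mass_ge_floor` on `coreBox` at `ρ = r₀ = t₀ = β^{-1/2}`). [cite: Luscher1983, §3] -/
theorem fpBOKernel_recordProfile_fpWeight_ge_floor {β : ℝ} (hβ : 900 ≤ β) :
    transferKernel su2Rep ((L : ℝ) ^ 3 * β) (1 : GaugeConfig 3 1 SU2) 1 *
        (Real.exp (-((Fintype.card (Edge 3 L) : ℝ) * (2 + 2 * Real.sqrt 2) ^ 2 + 100 * (Fintype.card (Plaquette 3 L × Fin 3) : ℝ) +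
            (Fintype.card (Plaquette 3 L) : ℝ) * (29376 + 700569))) *
          (fpZ (powScale 1 β) * ((Real.sqrt β)⁻¹ ^ 3 / 10) ^ Fintype.card {x : Site 3 L // ¬x = 0} *
            (∫ v in coreBox L β, recordProfile L β (linkEmbed L v) ∂orthoTransverse L) ^ 2)) ≤
      fpBOKernel L β (recordProfile L β) (fpWeight L (powScale 1 β)) 1 1 := by
  have hβ1 : 1 ≤ β := by linarith
  have hβp : 0 < β := by linarith
  obtain ⟨hΩm, hΩ01, hΩabs, -⟩ := recordProfile_fields L
  have hΩt : ∀ v : Edge 3 L → Fin 3 → ℝ, recordProfile L β (linkEmbed L v) ≠ 0 → v ∈ capBalancedSet L ∧ ‖linkEmbed L v‖ ≤ min (1 / 40) (powScale (1 / 2) β * btLog β) :=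
    fun v hv => ⟨(recordProfile_support L hv).1, (recordProfile_support L hv).2.2⟩
  have hs : 0 < Real.sqrt β := Real.sqrt_pos.2 hβp
  have hs30 : 30 ≤ Real.sqrt β := by
    rw [show (30 : ℝ) = Real.sqrt (30 ^ 2) by rw [Real.sqrt_sq (by norm_num)]]; exact Real.sqrt_le_sqrt (by linarith)
  have ht₀ : (Real.sqrt β)⁻¹ ≤ 1 / 30 := by rw [one_div]; exact inv_anti₀ (by norm_num) hs30
  have hρ : 0 < (Real.sqrt β)⁻¹ := inv_pos.2 hs
  have hρ1 : (Real.sqrt β)⁻¹ ≤ 1 := ht₀.trans (by norm_num)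
  have hCsub : ∀ v ∈ coreBox L β, v ∈ capBalancedSet L ∧ ‖linkEmbed L v‖ ≤ (Real.sqrt β)⁻¹ ∧ ∀ (e : Edge 3 L) (c : Fin 3), |v e c| ≤ (Real.sqrt β)⁻¹ :=
    fun v hv => hv
  have h := reference_mass_ge_floor (L := L) hβp (hΩm β) (hΩabs β) (fun x => (hΩ01 β x).1) hΩt (measurableSet_coreBox L β) ht₀ hCsub (powScale 1 β) hρ hρ1
  rw [← fpBOKernel_eq_integral_prod β (hΩm β) (hΩabs β) (measurable_fpWeight L (powScale 1 β)) (abs_fpWeight_le L (powScale 1 β)) 1 1] at h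
  refine le_trans ?_ h
  have hK1 : 0 ≤ transferKernel su2Rep ((L : ℝ) ^ 3 * β) (1 : GaugeConfig 3 1 SU2) 1 := (transferKernel_pos su2Rep _ _ _).le
  refine mul_le_mul_of_nonneg_left (mul_le_mul_of_nonneg_right (Real.exp_le_exp.mpr (floor_exponent_ge L hβ1)) ?_) hK1
  have := (fpZ_pos (powScale_pos 1 β)).le
  positivity

/-- ★★ **THE REWEIGHTED RECORD REFERENCE MASS IS `O(1) × btC·K₁(1,1)`** (see the module docstring). [cite: Luscher1983, §3] -/
theorem record_reweighted_reference_mass_le_btC (hL : 2 ≤ L) :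
    ∃ Cr β₆ : ℝ, 0 ≤ Cr ∧ ∀ β : ℝ, β₆ ≤ β →
      fpBOKernel L β (fun x => recordProfile L β x * (1 + β * ‖x‖ ^ 2) ^ 4) (fpWeight L (powScale 1 β)) 1 1 ≤
        Cr * (btC L β (recordProfile L β) (btEps β) (5 * (powScale (1 / 2) β * btLog β ^ 2)) *
          transferKernel su2Rep ((L : ℝ) ^ 3 * β) (1 : GaugeConfig 3 1 SU2) 1) := by
  obtain ⟨CA, β₅, hCA, hup⟩ := record_reference_mass_le L hL
  set n : ℕ := Fintype.card {x : Site 3 L // ¬x = 0} with hn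
  set cL : ℝ := (Fintype.card (Edge 3 L) : ℝ) * (2 + 2 * Real.sqrt 2) ^ 2 + 100 * (Fintype.card (Plaquette 3 L × Fin 3) : ℝ) +
      (Fintype.card (Plaquette 3 L) : ℝ) * (29376 + 700569) with hcL
  set P : ℝ := 5 * Real.exp 1 * 4 ^ (3 * n) * (3 * n).factorial * ((π ^ 2 / 12) ^ n * (3 * (L : ℝ)) ^ (3 * n) * 3 ^ (3 * n)) with hP
  have hP0 : 0 ≤ P := by rw [hP]; positivity
  -- the cut is eventually at most `btC·K₁`
  obtain ⟨β₇, hβ₇⟩ := Filter.eventually_atTop.mp (eventually_cut_le_mul_btC (L := L) one_pos)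
  refine ⟨2 * (10 ^ n * P * CA / Real.exp (-cL)), max (max β₅ β₇) 900, by positivity, fun β hβ => ?_⟩
  have hβ5 : β₅ ≤ β := (le_max_left _ _).trans ((le_max_left _ _).trans hβ)
  have hβ7 : β₇ ≤ β := (le_max_right _ _).trans ((le_max_left _ _).trans hβ)
  have hβ9 : 900 ≤ β := (le_max_right _ _).trans hβ
  have hβp : 0 < β := by linarith
  obtain ⟨hΩm, hΩ01, hΩabs, -⟩ := recordProfile_fields L
  have hK1p : 0 < transferKernel su2Rep ((L : ℝ) ^ 3 * β) (1 : GaugeConfig 3 1 SU2) 1 := transferKernel_pos su2Rep _ _ _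
  have hZ : 0 < fpZ (powScale 1 β) := fpZ_pos (powScale_pos 1 β)
  have hρ : 0 < (Real.sqrt β)⁻¹ := inv_pos.2 (Real.sqrt_pos.2 hβp)
  set θ : ℝ := ∫ v in coreBox L β, recordProfile L β (linkEmbed L v) ∂orthoTransverse L with hθ
  set R0 : ℝ := fpBOKernel L β (recordProfile L β) (fpWeight L (powScale 1 β)) 1 1 with hR0
  set BK : ℝ := btC L β (recordProfile L β) (btEps β) (5 * (powScale (1 / 2) β * btLog β ^ 2)) *
      transferKernel su2Rep ((L : ℝ) ^ 3 * β) (1 : GaugeConfig 3 1 SU2) 1 with hBK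
  -- (1) the ceiling
  have h1 : fpBOKernel L β (fun x => recordProfile L β x * (1 + β * ‖x‖ ^ 2) ^ 4) (fpWeight L (powScale 1 β)) 1 1 ≤
      transferKernel su2Rep ((L : ℝ) ^ 3 * β) (1 : GaugeConfig 3 1 SU2) 1 * (P * (fpZ (powScale 1 β) * (Real.sqrt β)⁻¹ ^ (3 * n)) * (CA * θ ^ 2)) := by
    have h := hup β hβ5
    have e : 5 * Real.exp 1 * 4 ^ (3 * n) * (3 * n).factorial *
        (fpZ (powScale 1 β) * (π ^ 2 / 12) ^ n * (3 * (L : ℝ)) ^ (3 * n) * 3 ^ (3 * n) * ((Real.sqrt β)⁻¹) ^ (3 * n)) =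
        P * (fpZ (powScale 1 β) * (Real.sqrt β)⁻¹ ^ (3 * n)) := by rw [hP]; ring
    rw [e] at h; exact h
  -- (2) the floor
  have h2 : transferKernel su2Rep ((L : ℝ) ^ 3 * β) (1 : GaugeConfig 3 1 SU2) 1 * (Real.exp (-cL) * (fpZ (powScale 1 β) * ((Real.sqrt β)⁻¹ ^ 3 / 10) ^ n * θ ^ 2)) ≤ R0 := by
    have h := fpBOKernel_recordProfile_fpWeight_ge_floor L hβ9
    rw [← hn, ← hcL] at h; exact h
  -- (3) `R0 = btC·K₁ + cut ≤ 2·btC·K₁`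
  have h3 : R0 ≤ 2 * BK := by
    have hsplit := fpBOKernel_fpWeight_split (L := L) β (powScale 1 β) (5 * (powScale (1 / 2) β * btLog β ^ 2)) (hΩm β) (hΩabs β) 1 1
    have hcore : fpBOKernel L β (recordProfile L β) (coreWeight L (powScale 1 β) (5 * (powScale (1 / 2) β * btLog β ^ 2))) 1 1 = BK := by
      rw [hBK]; unfold btC btEps; rw [div_mul_cancel₀ _ hK1p.ne']
    have hcut : fpBOKernel L β (recordProfile L β) (tailWeight L (powScale 1 β) (5 * (powScale (1 / 2) β * btLog β ^ 2))) 1 1 ≤ 1 * BK := by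
      have h := hβ₇ β hβ7
      rw [hBK]; unfold btEps at h ⊢; unfold recordProfile; exact h
    rw [hR0, hsplit, hcore]; linarith
  -- (4) combine: `K₁·fpZ·ρ^{3n}·θ² ≤ (10^n/e^{-cL})·R0 ≤ (10^n/e^{-cL})·2·BK`
  have hE : 0 < Real.exp (-cL) := Real.exp_pos _
  have e4 : transferKernel su2Rep ((L : ℝ) ^ 3 * β) (1 : GaugeConfig 3 1 SU2) 1 * (P * (fpZ (powScale 1 β) * (Real.sqrt β)⁻¹ ^ (3 * n)) * (CA * θ ^ 2)) =
      (10 ^ n * P * CA / Real.exp (-cL)) *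
        (transferKernel su2Rep ((L : ℝ) ^ 3 * β) (1 : GaugeConfig 3 1 SU2) 1 * (Real.exp (-cL) * (fpZ (powScale 1 β) * ((Real.sqrt β)⁻¹ ^ 3 / 10) ^ n * θ ^ 2))) := by
    rw [div_pow, ← pow_mul]
    field_simp
  calc fpBOKernel L β (fun x => recordProfile L β x * (1 + β * ‖x‖ ^ 2) ^ 4) (fpWeight L (powScale 1 β)) 1 1
      ≤ _ := h1
    _ = _ := e4
    _ ≤ (10 ^ n * P * CA / Real.exp (-cL)) * R0 := mul_le_mul_of_nonneg_left h2 (by positivity)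
    _ ≤ (10 ^ n * P * CA / Real.exp (-cL)) * (2 * BK) := mul_le_mul_of_nonneg_left h3 (by positivity)
    _ = 2 * (10 ^ n * P * CA / Real.exp (-cL)) * BK := by ring

end Summit.QuantumFields.YangMills.Theorems.FemtoTransferGap.RateTube

end
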